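/-
Origin: expansion seat `planner-pub-hodgecm-qw8b-0`, handover 2026-08-18T03:51:53Z (`HOME/pub-hodgecm-qw8b/PullTypeFibres.lean`, md5 377bee69, 128 lines);
landed by the gen-5 packager in gate run 20 as `HodgeCM/CM/PullTypeFibres.lean` (verbatim).
-/
/-
Copyright: pub-hodgecm formalisation cell (harness21, 2026). New file (not vendored).
Unit pub-hodgecm-qw8b (QW8 seat 2), session planner-pub-hodgecm-qw8b-0.
-/
import Summits.HodgeConjecture.HodgeCM.CM.LefschetzChar_2

/-!
# The fibres of `(Θ, s) ↦ Θ^{(s)}`: pulled-back types agree iff the data differ by a Galois twist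

Pure CM-combinatorics over `HodgeCM.CM.LefschetzChar` (no geometry, no facts).

For a CM field `F` GALOIS over `ℚ` the group `E = GalT F` of Galois translates acts simply transitively on
`Hom(F, ℂ)`, and `pullType Θ s = {P ∈ E | P s ∈ Θ}` is the CM type `Θ` read in `E` along the base point `s`
("`Θ s⁻¹`").  We define the twist `CMTypeOps.twist g Θ = {τ | τ ∘ g ∈ Θ} = Θ ∘ g⁻¹` of a CM type by an
automorphism `g ∈ Aut(F)` and prove (`pullType_eq_pullType_iff`):

  `pullType Θ s = pullType Θ' s'  ↔  ∃ g : F ≃ₐ[ℚ] F, s = s' ∘ g ∧ Θ' = twist g Θ`.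

Geometric meaning ([QW8] §2.1 (b); `pub-hodgecm-qw8b/QW8B-AUDIT.md` §3.2 (T1)): `A_{(F, Θ ∘ g⁻¹)}` is `A_{(F, Θ)}` with
the `F`-action twisted by `g`, and under this identification the `s'`-eigenline of the first is the `s`-eigenline
of the second (`s = s' ∘ g`).  Together with `AsymCoeff.lean` (`lefChar_eq_zero_balanced`) this is the combinatorial
part of the dictionary between `lefChar Θ S = 0` and invariance under Milne's Lefschetz group behind
`HodgeCM.Universe.Qw8Milne` ([QW8] Thm 2.5 (iv)).  Also: `twist` is an action (`twist_one`, `twist_mul`), commutes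
with `bar` (`twist_bar`), and `pullType (twist g Θ) s = pullType Θ (s ∘ g)` (`pullType_twist`).
-/

noncomputable section

open NumberField NumberField.ComplexEmbedding

namespace HodgeCM

open Literature.AlgebraicGeometry.Motives (CMType)
open CMTypeOps

namespace CMTypeOps

variable {K : Type} [Field K] [CharZero K]

/-- Conjugation commutes with pre-composition by an automorphism. -/
theorem conjugate_comp (τ : K →+* ℂ) (g : K ≃ₐ[ℚ] K) :
    conjugate (τ.comp (g : K →+* K)) = (conjugate τ).comp (g : K →+* K) := by
  ext x
  simp [conjugate_coe_eq]

/-- The twist `Θ ∘ g⁻¹ = {τ | τ ∘ g ∈ Θ}` of a CM type by an automorphism `g` of the field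
([QW8] §2.1 (b): the type of `A_{(F,Θ)}` with the `F`-action precomposed with `g⁻¹`). -/
def twist (g : K ≃ₐ[ℚ] K) (Θ : CMType K) : CMType K :=
  ⟨{τ | τ.comp (g : K →+* K) ∈ Θ.1}, fun τ =>
    show τ.comp (g : K →+* K) ∈ Θ.1 ↔ (conjugate τ).comp (g : K →+* K) ∉ Θ.1 from
      conjugate_comp τ g ▸ mem_iff_conjugate_notMem Θ (τ.comp (g : K →+* K))⟩

/-- (Ported verbatim from the HodgeCMPerL package; no docstring in the source.) -/
@[simp] theorem mem_twist_iff (g : K ≃ₐ[ℚ] K) (Θ : CMType K) (τ : K →+* ℂ) :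
    τ ∈ (twist g Θ).1 ↔ τ.comp (g : K →+* K) ∈ Θ.1 := Iff.rfl

/-- (Ported verbatim from the HodgeCMPerL package; no docstring in the source.) -/
theorem twist_one (Θ : CMType K) : twist 1 Θ = Θ := by
  apply Subtype.ext
  ext τ
  have e : τ.comp ((1 : K ≃ₐ[ℚ] K) : K →+* K) = τ := by ext x; simp
  rw [mem_twist_iff, e]

/-- (Ported verbatim from the HodgeCMPerL package; no docstring in the source.) -/
theorem twist_mul (g h : K ≃ₐ[ℚ] K) (Θ : CMType K) : twist (g * h) Θ = twist g (twist h Θ) := by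
  apply Subtype.ext
  ext τ
  have e : τ.comp ((g * h : K ≃ₐ[ℚ] K) : K →+* K) = (τ.comp (g : K →+* K)).comp (h : K →+* K) := by
    ext x; simp [AlgEquiv.mul_apply]
  rw [mem_twist_iff, mem_twist_iff, mem_twist_iff, e]

/-- Twisting commutes with passing to the conjugate type. -/
theorem twist_bar (g : K ≃ₐ[ℚ] K) (Θ : CMType K) : twist g (bar Θ) = bar (twist g Θ) := by
  apply Subtype.ext
  ext τ
  simp only [mem_twist_iff, mem_bar_iff]

end CMTypeOps

section Fibres

variable {F : Type} [Field F] [NumberField F]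

attribute [local instance] Classical.propDecidable

/-- Reading a twisted type along `s` = reading the type along `s ∘ g`. -/
theorem pullType_twist (g : F ≃ₐ[ℚ] F) (Θ : CMType F) (s : F →+* ℂ) :
    pullType (twist g Θ) s = pullType Θ (s.comp (g : F →+* F)) := by
  apply Subtype.ext
  ext P
  rw [mem_pullType, mem_pullType, mem_twist_iff, GalT.apply_comp]

/-- Every embedding is a Galois translate of a fixed one (`F` Galois: `E` acts transitively). -/
theorem exists_galT_apply_eq [IsGalois ℚ F] (s τ : F →+* ℂ) : ∃ P : GalT F, P.1 s = τ :=
  ⟨translate s τ, translate_apply_self s τ⟩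

/-- **The fibres of `(Θ, s) ↦ Θ^{(s)}`.**  For `F` Galois, two pulled-back types agree iff the base points differ
by an automorphism `g` (`s = s' ∘ g`) and the types by the corresponding twist (`Θ' = Θ ∘ g⁻¹`). -/
theorem pullType_eq_pullType_iff [IsGalois ℚ F] (Θ Θ' : CMType F) (s s' : F →+* ℂ) :
    pullType Θ s = pullType Θ' s' ↔
      ∃ g : F ≃ₐ[ℚ] F, s = s'.comp (g : F →+* F) ∧ Θ' = twist g Θ := by
  constructor
  · intro h
    obtain ⟨g, hg⟩ := exists_aut_eq s' s
    refine ⟨g, hg, ?_⟩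
    apply Subtype.ext
    ext τ
    obtain ⟨P, rfl⟩ := exists_galT_apply_eq s' τ
    rw [mem_twist_iff, ← GalT.apply_comp, ← hg, ← mem_pullType Θ s P, h, mem_pullType]
  · rintro ⟨g, hs, hΘ⟩
    rw [hΘ, pullType_twist, hs]

/-- The twist is recovered from the base points: if `Θ^{(s' ∘ g)} = Θ'^{(s')}` then `Θ' = Θ ∘ g⁻¹`. -/
theorem eq_twist_of_pullType_eq [IsGalois ℚ F] (Θ Θ' : CMType F) (s' : F →+* ℂ) (g : F ≃ₐ[ℚ] F)
    (h : pullType Θ (s'.comp (g : F →+* F)) = pullType Θ' s') : Θ' = twist g Θ := by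
  obtain ⟨g', hg', hΘ⟩ := (pullType_eq_pullType_iff Θ Θ' _ s').mp h
  have : g' = g := (comp_aut_injective s' hg').symm
  rw [hΘ, this]

/-- Same type, two base points: `Θ^{(s)} = Θ^{(s')}` iff `s = s' ∘ g` for an automorphism `g` FIXING the type
(`Θ ∘ g⁻¹ = Θ`, i.e. `g` in the stabiliser `H_Θ`; cf. [QW8] §2.1 "right stabiliser"). -/
theorem pullType_eq_pullType_same_iff [IsGalois ℚ F] (Θ : CMType F) (s s' : F →+* ℂ) :
    pullType Θ s = pullType Θ s' ↔ ∃ g : F ≃ₐ[ℚ] F, s = s'.comp (g : F →+* F) ∧ twist g Θ = Θ := by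
  rw [pullType_eq_pullType_iff]
  exact exists_congr (fun g => and_congr Iff.rfl eq_comm)

end Fibres

end HodgeCM

end
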